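import Mathlib
import Summits.Ventures.DiscreteObjects.Mahler.CensusKernelDeg22C1
import Summits.Ventures.DiscreteObjects.Mahler.CensusKernelDeg22NL1
import Summits.Ventures.DiscreteObjects.Mahler.CensusKernelDeg22NL2

/-!
# Kernel census, degree 22 at `B = 61/50` (part Final): assembly — the census row of degree 22

Cell `pub-namedobj`, seat `pub-namedobj-mahler-g17`. Framing: lottery ticket; floor = certified bounds/negative ranges.

Part of the kernel proof of `DegreeCensus 22 (61/50) coresDeg22` (see part A for the method: census search with
Toeplitz/resultant cuts, kernel-certified explicit-auxiliary-function cuts and certified leaf thresholds at `B = 61/50`;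
601305 leaves with `c_1 >= 0`, 50871 survivors certified by extended certificates `CertX`: base red/cyc/exc or trace-Graeffe `tgr`).
This last part assembles the node lemmas of parts B… into `certified22` (every survivor with `c₁ ≥ 0` carries a
valid certificate) and proves `DegreeCensus 22 (61/50) coresDeg22` by
`degreeCensus_of_certified_nonnegXC` (`x ↦ -x` symmetry; standard axioms).
CONTROL/replication (MRW08 Table 1 row `D = 22`; print complete to degree 44), not new ground.
-/

namespace Summit.Ventures.DiscreteObjects.Mahler

open Polynomial

/-- Every survivor with `c₁ ≥ 0` of the degree-22 search (with cuts) is certified. -/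
theorem certified22 : ∀ a ∈ censusSearchC T22 CT22 11 [] [], 0 ≤ a.getD 0 0 →
    ∃ c, checkCertX 61 50 11 coresDeg22 LC22 (1 :: palC a) c = true := by
  intro a ha hsign
  rw [show censusSearchC T22 CT22 11 [] [] = censusSearchC T22 CT22 11 [] (psumsRev [] 0) from rfl,
    mem_censusSearchC_node_iff (pre := []) (n := 0) rfl, (by decide +kernel : nodeLoC T22 CT22 [] (psumsRev [] 0) = -2),
    (by decide +kernel : nodeHiC T22 CT22 [] (psumsRev [] 0) = 2)] at ha
  obtain ⟨a1, ha1, ha⟩ := ha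
  simp only [List.nil_append, Nat.reduceAdd] at ha
  rw [getD_zero_of_mem_censusSearchC_cons ha] at hsign
  rw [mem_icc] at ha1
  obtain ⟨hlo1, hhi1⟩ := ha1
  interval_cases a1
  · rw [mem_censusSearchC_node_iff (pre := [0]) (n := 1) rfl,
      (by decide +kernel : nodeLoC T22 CT22 [0] (psumsRev [0] 1) = -2),
      (by decide +kernel : nodeHiC T22 CT22 [0] (psumsRev [0] 1) = 2)] at ha
    obtain ⟨a2, ha2, ha⟩ := ha
    simp only [List.cons_append, List.nil_append, Nat.reduceAdd] at ha
    rw [mem_icc] at ha2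
    obtain ⟨hlo2, hhi2⟩ := ha2
    interval_cases a2
    · exact certified22n_p0_m2 a ha
    · exact certified22n_p0_m1 a ha
    · exact certified22n_p0_p0 a ha
    · exact certified22n_p0_p1 a ha
    · exact certified22n_p0_p2 a ha
  · rw [mem_censusSearchC_node_iff (pre := [1]) (n := 1) rfl,
      (by decide +kernel : nodeLoC T22 CT22 [1] (psumsRev [1] 1) = -1),
      (by decide +kernel : nodeHiC T22 CT22 [1] (psumsRev [1] 1) = 2)] at ha
    obtain ⟨a2, ha2, ha⟩ := ha
    simp only [List.cons_append, List.nil_append, Nat.reduceAdd] at ha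
    rw [mem_icc] at ha2
    obtain ⟨hlo2, hhi2⟩ := ha2
    interval_cases a2
    · exact certified22n_p1_m1 a ha
    · exact certified22n_p1_p0 a ha
    · exact certified22n_p1_p1 a ha
    · exact certified22n_p1_p2 a ha
  · rw [mem_censusSearchC_node_iff (pre := [2]) (n := 1) rfl,
      (by decide +kernel : nodeLoC T22 CT22 [2] (psumsRev [2] 1) = 0),
      (by decide +kernel : nodeHiC T22 CT22 [2] (psumsRev [2] 1) = 4)] at ha
    obtain ⟨a2, ha2, ha⟩ := ha
    simp only [List.cons_append, List.nil_append, Nat.reduceAdd] at ha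
    rw [mem_icc] at ha2
    obtain ⟨hlo2, hhi2⟩ := ha2
    interval_cases a2
    · exact certified22n_p2_p0 a ha
    · exact certified22n_p2_p1 a ha
    · exact certified22n_p2_p2 a ha
    · exact certified22n_p2_p3 a ha
    · exact certified22n_p2_p4 a ha

/-- **Degree-22 census below `61/50` (kernel theorem):** `DegreeCensus 22 (61/50) coresDeg22` — every irreducible
`P ∈ ℤ[X]` of degree `22` with `1 < M(P) < 61/50` is `± c(± x)` for one of the 48 listed census cores of `coresDeg22`
(of which only `c22_01 = mrwPoly22(-x)`, `M = 1.20501985…`, lies below `61/50`): MRW08 Table 1 row `D = 22` re-derived inside the kernel —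
CONTROL/replication row. -/
theorem degreeCensus_twentytwo : DegreeCensus 22 (61 / 50) coresDeg22 := by
  have h := degreeCensus_of_certified_nonnegXC (Bn := 61) (Bd := 50) (d := 11) (by norm_num) (by norm_num) (by norm_num)
    (by decide) thresholdsValidX_T22 cutTableValidX_CT22 leafCutsValid_LC22 (by have := smythTheta_gt; push_cast; linarith)
    certified22
  norm_num at h
  exact h

end Summit.Ventures.DiscreteObjects.Mahler
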